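import Literature.Computability.Complexity.UnaryOffsets
import HarnessLib

/-!
# Windows of concrete strings: `window` against `take`/`drop`, leading symbols and prefixes

Trunk `CplxCore`, a small toolkit continuing `UnaryOffsets.lean` (`window s o L`, the `L` symbols
of `s` from offset `o`, zero-padded; `window_eq_ofFn`, `getD_window`). The witness languages of
the counting arguments (Toda's theorem, threshold languages in `PP`) read fields of a witness or
coin string through `window`; their counts are computed with `take`/`drop` (`cnt_take_drop`,
`cnt_blocks`). These lemmas translate between the two on strings of known length:

* `window_eq_take_drop` (inside the string a window is `(s.drop o).take L`), `window_zero_self`,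
  `window_zero_eq_take`;
* `window_cons_succ`, `window_cons_one`, `window_cons_one_add`, `window_append_length_add`
  (windows past leading symbols / a known prefix);
* `window_take` (windows inside a prefix), `ofFn_getD_self` (a string is `ofFn` of its reader),
  `exists_ofFn_eq`.

## References

* S. Arora, B. Barak, *Computational Complexity: A Modern Approach*, CUP 2009, §1.2 (strings).
-/

namespace Literature.Computability.Complexity

open UnaryOffsets

/-- **A window inside the string is a `drop`/`take`.** [folklore] -/
theorem window_eq_take_drop {s : List Bool} {o L : ℕ} (h : o + L ≤ s.length) : window s o L = (s.drop o).take L := by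
  rw [window, List.take_append_of_le_length (by rw [List.length_drop]; omega)]

/-- The full window of a string is the string. [folklore] -/
theorem window_zero_self {s : List Bool} {L : ℕ} (h : s.length = L) : window s 0 L = s := by
  rw [window_eq_take_drop (by omega), List.drop_zero, List.take_of_length_le (le_of_eq h)]

/-- An initial window is a prefix. [folklore] -/
theorem window_zero_eq_take {s : List Bool} {L : ℕ} (h : L ≤ s.length) : window s 0 L = s.take L := by
  rw [window_eq_take_drop (by omega), List.drop_zero]

/-- Windows past a leading symbol. [folklore] -/
@[simp] theorem window_cons_succ (b : Bool) (s : List Bool) (o L : ℕ) : window (b :: s) (o + 1) L = window s o L := by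
  rw [window, window, List.drop_succ_cons]

/-- Windows past a leading symbol (offset `1`). [folklore] -/
@[simp] theorem window_cons_one (b : Bool) (s : List Bool) (L : ℕ) : window (b :: s) 1 L = window s 0 L :=
  window_cons_succ b s 0 L

/-- Windows past a leading symbol (offset `1 + o`). [folklore] -/
@[simp] theorem window_cons_one_add (b : Bool) (s : List Bool) (o L : ℕ) :
    window (b :: s) (1 + o) L = window s o L := by
  rw [Nat.add_comm, window_cons_succ]

/-- Windows past a known prefix. [folklore] -/
theorem window_append_length_add (a s : List Bool) (o L : ℕ) :
    window (a ++ s) (a.length + o) L = window s o L := by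
  rw [window, window, ← List.drop_drop, List.drop_left]

/-- Windows inside a prefix. [folklore] -/
theorem window_take {s : List Bool} {o L m : ℕ} (h : o + L ≤ m) : window (s.take m) o L = window s o L := by
  rw [window_eq_ofFn, window_eq_ofFn]
  congr 1
  funext c
  rw [List.getD_eq_getElem?_getD, List.getD_eq_getElem?_getD, List.getElem?_take_of_lt (by omega)]

/-- A string is `ofFn` of its `getD` reader. [folklore] -/
theorem ofFn_getD_self (l : List Bool) : (List.ofFn fun c : Fin l.length => l.getD c false) = l := by
  apply List.ext_getElem (by simp)
  intro i h₁ h₂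
  rw [List.getElem_ofFn, List.getD_eq_getElem?_getD, List.getElem?_eq_getElem h₂, Option.getD_some]

/-- A string of length `n` is `ofFn` of a function on `Fin n`. [folklore] -/
theorem exists_ofFn_eq {y : List Bool} {n : ℕ} (h : y.length = n) : ∃ u : Fin n → Bool, List.ofFn u = y := by
  subst h
  exact ⟨_, ofFn_getD_self y⟩

end Literature.Computability.Complexity
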